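/-
Copyright: derived here (Resolution Observatory cell `pub-rosobs`, carver gen 58). AI-written Lean; AI review is weaker than expert
review.  Commutative-algebra bookkeeping for engine 1's THEOREM B″ (THEOREM-LT-eng1-g38 §11, CARVER-NOTES-eng1-g38 T61) in the cell's
POLYNOMIAL weighted-centre model `W(f)`: one-parameter Taylor coefficients of a multivariate polynomial and the `σ`-LAYERS of the
two-class substitution `f ↦ f + σℓ + σ^{p+1}d`, `W ↦ W + σ^p c`.  Instrument — NOT a resolution theorem and NOT a statement about the
invariant of [AbramovichTemkinWlodarczyk2024].
-/
import Mathlib.Algebra.Polynomial.Expand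
import Mathlib.Algebra.Polynomial.AlgebraMap
import Mathlib.Algebra.Polynomial.Eval.Coeff
import Mathlib.RingTheory.MvPolynomial.Homogeneous
import Mathlib.Algebra.MvPolynomial.PDeriv
import Mathlib.Tactic.Ring
import Mathlib.Tactic.Linarith
import HarnessLib

/-!
# One-parameter Taylor coefficients and the `σ`-layers of the two-class substitution (THEOREM B″ bookkeeping, T61)

Uniform value line: INSTRUMENT — elementary commutative algebra for engine 1's THEOREM B″ (THEOREM-LT-eng1-g38 §11) in the cell's
polynomial weighted-centre model `W(f)`; NOT a resolution theorem, NOT a statement about the Abramovich–Temkin–Włodarczyk invariant,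
NOT summit progress; AI-written Lean, AI review is weaker than expert review.

## Dictionary (THEOREM-LT §11 "(★) … compare σ-layers" ↔ this file)

The engine's step 1 reads the identity `F(f + σℓ(W) + σ^{p+1}d) + Q(W + σ^p c) = F(f) + Q(W)` (in `k[f, W, σ]`, `F` a form of degree
`p`, `Q` a form of degree `p+1`) LAYER BY LAYER in `σ`.  Here, over ANY commutative `k`-algebra `R` (no characteristic hypothesis — the
prime `p` enters THEOREM B″ only afterwards, through the Frobenius pin `WeightedCentreFrobeniusPin` and the binomials of
`WeightedCentreTwoClassArith`), with base points `x : ι → R`, `y : ι' → R` and directions `ℓ, d : ι → R`, `c : ι' → R`: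

* `taylorLine x u F = F(x + s·u) ∈ R[s]` and its coefficients, the ONE-PARAMETER TAYLOR COEFFICIENTS `T_a(x; u) := [s^a] F(x + s u)`
  (the engine's `D^{(a)}_u F (x)`): `coeff_taylorLine_zero` (`T_0 = F(x)`), `coeff_taylorLine_one` (`T_1 = Σ_i u_i ∂_i F(x)`),
  `coeff_taylorLine_eq_zero_of_totalDegree_lt`, `coeff_taylorLine_of_isHomogeneous` (`T_n = F(u)` for a form of degree `n`),
  `natDegree_coeff_taylorLine_le` (for `u = ℓ + τd`: `T_a(x; ℓ + τd)` has `τ`-degree `≤ a`).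
* `shiftF p x ℓ d F = F(x + σℓ + σ^{p+1}d)`, `shiftQ p y c Q = Q(y + σ^p c)` ∈ `R[σ]`; `shiftQ_eq_expand`, `shiftF_eq_sum`
  (`F(x + σ(ℓ + σ^p d)) = Σ_a σ^a · T_a(x; ℓ + τd)|_{τ = σ^p}`), and the coefficient formulas `coeff_shiftQ`, `coeff_shiftF`.
* THE LAYERS (hypothesis `layers : shiftF p x ℓ d F + shiftQ p y c Q = C (F(x) + Q(y))`, `F` a form of degree `p`, `Q` a form of
  degree `p+1`, `2 ≤ p`; exponents `a + p·b` with `0 ≤ b ≤ a ≤ p` are read off uniquely):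
  `layer_one` — `[σ¹]`: `Σ_i ℓ_i ∂_i F(x) = 0` (engine: "`ℓ_i ≠ 0 ⇒ ∂_{f_i}F = 0`" after `W`-extraction and a linear change);
  `layer_lt` — `[σ^k]`, `2 ≤ k < p`: `T_k(x; ℓ) = 0`;
  `layer_p` — `[σ^p]`: `F(ℓ) + Σ_j c_j ∂_j Q(y) = 0` (engine: "`Σ a_i ℓ_i^p + ∂_c Q = 0`, so `Q ∋ −Σ a_iℓ_i(W)^p W_n`");
  `layer_succ` — `[σ^{p+1}]`: `Σ_i d_i ∂_i F(x) = 0`;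
  `layer_mul` — `[σ^{kp}]`, `2 ≤ k ≤ p+1`: `T_k(y; c)(Q) + T_{k-1}(ℓ; d)(F) = 0` (engine: "`D_c^{(k)}Q = 0 (2 ≤ k ≤ p)`" once the
  `F`-term is killed by the normal form, and at `k = p+1`: "`Σ a_i d_i^p + F₀(d″) + Q(c) = 0`" = `layer_top`: `F(d) + Q(c) = 0`).

* PROPOSITION F (i) packaged (v2, THEOREM-LT §15 / CARVER T71 (a); section `PropF`): `taylorLine_eq_C_of_shiftF_eq_C` (`Q := 0`:
  `F(x + σℓ + σ^{p+1}d) = F(x)` ⇒ `F(x + sℓ) = F(x)` — every Taylor coefficient along `ℓ` vanishes), `taylorLine_eq_C_of_shiftF_zero_eq_C`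
  (the `b`-step via injectivity of `expand`), `taylorLine_eq_C_map` (specialise `W ↦ W₀`).

NOT here: the `W_j`-coefficient extraction turning `layer_one` into `Σ_i c_{ij} ∂_i F = 0 ∀ j` and the Frobenius normal form
(`WeightedCentreFrobeniusPin.eq_zero_of_sum_X_mul_eq_zero`, `pderiv_eq_zero_and_normalForm`), the `(P)`-consequences
(`r ≥ 1`, `c ≠ 0`, `a_i ≠ 0`, `n ≥ 2`), COROLLARY B‴.

In-tree neighbours (same folklore over a base ring, other APIs): `HyperbolicPolynomials.HyperbolicityCone.linePoly` (with
`coeff_taylorLine_eq_eval`), `RuledSurfaceLines.coeff_aeval_line_of_totalDegree_le`; here the polynomial has coefficients in `k` and the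
points live in a `k`-algebra, which is what the mixed coefficients `M_a ∈ R[τ]` need.

References: the computation is engine 1's (THEOREM-LT-eng1-g38 §11 step 1); Taylor expansion of polynomials [Lang2002, Ch. IV §1];
context [AbramovichTemkinWlodarczyk2024] §5 (graded algebra of a weighted centre).  Statements and formalisation ours, elementary.
-/

namespace Literature.AlgebraicGeometry.Resolution.WeightedBlowup

namespace TaylorLayers

variable {k : Type*} [CommRing k] {ι : Type*} {A : Type*} [CommRing A] [Algebra k A]

/-! ## One-parameter Taylor coefficients -/

/-- `F(x + s·u) ∈ A[s]` for a polynomial `F ∈ k[X_ι]`, a base point `x` and a direction `u` in a `k`-algebra `A` (ours).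
[cite: Lang2002, Ch. IV §1] -/
noncomputable def taylorLine (x u : ι → A) (F : MvPolynomial ι k) : Polynomial A :=
  MvPolynomial.aeval (fun i => Polynomial.C (x i) + Polynomial.X * Polynomial.C (u i)) F

/-- `taylorLine` on constants (ours, bookkeeping). [cite: Lang2002, Ch. IV §1] -/
@[simp] theorem taylorLine_C (x u : ι → A) (a : k) :
    taylorLine x u (MvPolynomial.C a) = Polynomial.C (algebraMap k A a) := by
  simp [taylorLine, Polynomial.C_eq_algebraMap]

/-- `taylorLine` on a variable (ours, bookkeeping). [cite: Lang2002, Ch. IV §1] -/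
@[simp] theorem taylorLine_X (x u : ι → A) (i : ι) :
    taylorLine x u (MvPolynomial.X i : MvPolynomial ι k) = Polynomial.C (x i) + Polynomial.X * Polynomial.C (u i) := by
  simp [taylorLine]

/-- `taylorLine` on sums (ours, bookkeeping). [cite: Lang2002, Ch. IV §1] -/
@[simp] theorem taylorLine_add (x u : ι → A) (F G : MvPolynomial ι k) :
    taylorLine x u (F + G) = taylorLine x u F + taylorLine x u G := by
  simp [taylorLine]

/-- `taylorLine` on products (ours, bookkeeping). [cite: Lang2002, Ch. IV §1] -/
@[simp] theorem taylorLine_mul (x u : ι → A) (F G : MvPolynomial ι k) :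
    taylorLine x u (F * G) = taylorLine x u F * taylorLine x u G := by
  simp [taylorLine]

/-- Coefficients of `P · (C a + X · C b)` (ours, bookkeeping). [cite: Lang2002, Ch. IV §1] -/
theorem coeff_mul_C_add_X_mul_C_zero (P : Polynomial A) (a b : A) :
    (P * (Polynomial.C a + Polynomial.X * Polynomial.C b)).coeff 0 = P.coeff 0 * a := by
  rw [Polynomial.mul_coeff_zero]
  simp

/-- Coefficients of `P · (C a + X · C b)` (ours, bookkeeping). [cite: Lang2002, Ch. IV §1] -/
theorem coeff_mul_C_add_X_mul_C_succ (P : Polynomial A) (a b : A) (n : ℕ) :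
    (P * (Polynomial.C a + Polynomial.X * Polynomial.C b)).coeff (n + 1) = P.coeff (n + 1) * a + P.coeff n * b := by
  rw [mul_add, Polynomial.coeff_add, Polynomial.coeff_mul_C, ← mul_assoc, Polynomial.coeff_mul_C, Polynomial.coeff_mul_X]

/-- `T_0 = F(x)`: the constant term of `F(x + s u)` (ours). [cite: Lang2002, Ch. IV §1] -/
theorem coeff_taylorLine_zero (x u : ι → A) (F : MvPolynomial ι k) :
    (taylorLine x u F).coeff 0 = MvPolynomial.aeval x F := by
  induction F using MvPolynomial.induction_on with
  | C a => simp
  | add p q hp hq => simp [hp, hq]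
  | mul_X p i hp => rw [taylorLine_mul, taylorLine_X, coeff_mul_C_add_X_mul_C_zero, hp, map_mul, MvPolynomial.aeval_X]

/-- `T_1 = Σ_i u_i · ∂_i F(x)`: the first-order Taylor coefficient (ours). [cite: Lang2002, Ch. IV §1] -/
theorem coeff_taylorLine_one [Fintype ι] [DecidableEq ι] (x u : ι → A) (F : MvPolynomial ι k) :
    (taylorLine x u F).coeff 1 = ∑ i, u i * MvPolynomial.aeval x (MvPolynomial.pderiv i F) := by
  induction F using MvPolynomial.induction_on with
  | C a => simp
  | add p q hp hq => simp [hp, hq, Finset.sum_add_distrib, mul_add]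
  | mul_X p i hp =>
      rw [taylorLine_mul, taylorLine_X, show (1 : ℕ) = 0 + 1 from rfl, coeff_mul_C_add_X_mul_C_succ, hp,
        coeff_taylorLine_zero]
      simp only [MvPolynomial.pderiv_mul, MvPolynomial.pderiv_X, map_add, map_mul,
        MvPolynomial.aeval_X, mul_add, Finset.sum_add_distrib]
      congr 1
      · rw [Finset.sum_mul]
        refine Finset.sum_congr rfl fun j _ => ?_
        ring
      · rw [Finset.sum_eq_single i]
        · simp [mul_comm]
        · intro j _ hj
          simp [hj]
        · intro h
          exact absurd (Finset.mem_univ i) h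

/-- `taylorLine` under a `k`-algebra map of the coefficient algebra (ours). [cite: Lang2002, Ch. IV §1] -/
theorem map_taylorLine {B : Type*} [CommRing B] [Algebra k B] (ψ : A →ₐ[k] B) (x u : ι → A) (F : MvPolynomial ι k) :
    (taylorLine x u F).map (ψ : A →+* B) = taylorLine (fun i => ψ (x i)) (fun i => ψ (u i)) F := by
  induction F using MvPolynomial.induction_on with
  | C a => simp [Polynomial.map_C, AlgHom.commutes]
  | add p q hp hq => simp [Polynomial.map_add, hp, hq]
  | mul_X p i hp => simp [Polynomial.map_mul, hp]

/-- With constant base point, `aeval (C ∘ x) G = C (aeval x G)` (ours, bookkeeping). [cite: Lang2002, Ch. IV §1] -/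
theorem aeval_C_base (x : ι → A) (G : MvPolynomial ι k) :
    MvPolynomial.aeval (fun i => Polynomial.C (x i)) G = Polynomial.C (MvPolynomial.aeval x G) := by
  induction G using MvPolynomial.induction_on with
  | C a => simp [Polynomial.C_eq_algebraMap]
  | add p q hp hq => simp [hp, hq]
  | mul_X p i hp => simp [hp]

/-! ## Degree bounds and the top coefficient -/

/-- The linear factor `C a + X · C b` has degree `≤ 1` (ours, bookkeeping). [cite: Lang2002, Ch. IV §1] -/
theorem natDegree_C_add_X_mul_C_le (a b : A) : (Polynomial.C a + Polynomial.X * Polynomial.C b).natDegree ≤ 1 := by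
  refine (Polynomial.natDegree_add_le _ _).trans (max_le (by simp) ?_)
  exact Polynomial.natDegree_mul_le.trans (by simpa using Polynomial.natDegree_X_le)

/-- Product of polynomials of degrees `≤ d_i`: degree `≤ Σ d_i` and the top coefficient is the product of the top coefficients
(ours, bookkeeping). [cite: Lang2002, Ch. IV §1] -/
theorem coeff_prod_sum_of_natDegree_le {κ : Type*} (s : Finset κ) (P : κ → Polynomial A) (d : κ → ℕ)
    (h : ∀ i ∈ s, (P i).natDegree ≤ d i) :
    (∏ i ∈ s, P i).natDegree ≤ ∑ i ∈ s, d i ∧ (∏ i ∈ s, P i).coeff (∑ i ∈ s, d i) = ∏ i ∈ s, (P i).coeff (d i) := by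
  classical
  induction s using Finset.induction_on with
  | empty => simp
  | insert a s ha ih =>
      obtain ⟨ih1, ih2⟩ := ih fun i hi => h i (Finset.mem_insert_of_mem hi)
      have hPa := h a (Finset.mem_insert_self a s)
      rw [Finset.prod_insert ha, Finset.sum_insert ha, Finset.prod_insert ha]
      refine ⟨Polynomial.natDegree_mul_le.trans (add_le_add hPa ih1), ?_⟩
      rw [Polynomial.coeff_mul_add_eq_of_natDegree_le hPa ih1, ih2]

/-- `taylorLine` of a monomial: `c · Π_i (C x_i + X C u_i)^{m_i}` (ours, bookkeeping). [cite: Lang2002, Ch. IV §1] -/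
theorem taylorLine_monomial (x u : ι → A) (m : ι →₀ ℕ) (c : k) :
    taylorLine x u (MvPolynomial.monomial m c) =
      Polynomial.C (algebraMap k A c) * ∏ i ∈ m.support, (Polynomial.C (x i) + Polynomial.X * Polynomial.C (u i)) ^ m i := by
  rw [taylorLine, MvPolynomial.aeval_monomial, Finsupp.prod, Polynomial.algebraMap_apply]

/-- The Taylor polynomial of a monomial of degree `|m|` has degree `≤ |m|` and top coefficient `c · u^m` (ours).
[cite: Lang2002, Ch. IV §1] -/
theorem natDegree_taylorLine_monomial_le (x u : ι → A) (m : ι →₀ ℕ) (c : k) :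
    (taylorLine x u (MvPolynomial.monomial m c)).natDegree ≤ m.degree ∧
      (taylorLine x u (MvPolynomial.monomial m c)).coeff m.degree = algebraMap k A c * ∏ i ∈ m.support, u i ^ m i := by
  have hfac : ∀ i ∈ m.support, ((Polynomial.C (x i) + Polynomial.X * Polynomial.C (u i)) ^ m i).natDegree ≤ m i := by
    intro i _
    refine Polynomial.natDegree_pow_le.trans ?_
    simpa using Nat.mul_le_mul_left (m i) (natDegree_C_add_X_mul_C_le (x i) (u i))
  obtain ⟨h1, h2⟩ := coeff_prod_sum_of_natDegree_le m.support _ (fun i => m i) hfac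
  have hdeg : m.degree = ∑ i ∈ m.support, m i := Finsupp.degree_apply m
  rw [taylorLine_monomial, hdeg]
  refine ⟨(Polynomial.natDegree_C_mul_le _ _).trans h1, ?_⟩
  rw [Polynomial.coeff_C_mul, h2]
  congr 1
  refine Finset.prod_congr rfl fun i hi => ?_
  have := Polynomial.coeff_pow_of_natDegree_le (m := m i) (natDegree_C_add_X_mul_C_le (x i) (u i))
  rw [mul_one] at this
  rw [this]
  simp

/-- The degree of `F(x + s u)` in `s` is at most the total degree of `F` (ours). [cite: Lang2002, Ch. IV §1] -/
theorem natDegree_taylorLine_le (x u : ι → A) (F : MvPolynomial ι k) :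
    (taylorLine x u F).natDegree ≤ F.totalDegree := by
  conv_lhs => rw [F.as_sum]
  rw [taylorLine, map_sum]
  refine Polynomial.natDegree_sum_le_of_forall_le _ _ fun m hm => ?_
  refine (natDegree_taylorLine_monomial_le x u m _).1.trans ?_
  rw [Finsupp.degree_apply]
  exact MvPolynomial.le_totalDegree hm

/-- `T_a = 0` for `a > deg F` (ours). [cite: Lang2002, Ch. IV §1] -/
theorem coeff_taylorLine_eq_zero_of_totalDegree_lt (x u : ι → A) (F : MvPolynomial ι k) {a : ℕ}
    (h : F.totalDegree < a) : (taylorLine x u F).coeff a = 0 :=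
  Polynomial.coeff_eq_zero_of_natDegree_lt ((natDegree_taylorLine_le x u F).trans_lt h)

/-- `T_n = F(u)` for a form `F` of degree `n`: the top Taylor coefficient of a homogeneous polynomial along `u` is its value at `u`
(ours). [cite: Lang2002, Ch. IV §1] -/
theorem coeff_taylorLine_of_isHomogeneous (x u : ι → A) {F : MvPolynomial ι k} {n : ℕ} (hF : F.IsHomogeneous n) :
    (taylorLine x u F).coeff n = MvPolynomial.aeval u F := by
  conv_lhs => rw [F.as_sum]
  conv_rhs => rw [F.as_sum]
  rw [taylorLine, map_sum, map_sum, Polynomial.finsetSum_coeff]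
  refine Finset.sum_congr rfl fun m hm => ?_
  have hmn : m.degree = n := by
    by_contra hne
    exact (MvPolynomial.mem_support_iff.mp hm) (hF.coeff_eq_zero hne)
  change (taylorLine x u (MvPolynomial.monomial m _)).coeff n = _
  rw [← hmn, (natDegree_taylorLine_monomial_le x u m _).2, MvPolynomial.aeval_monomial, Finsupp.prod]

/-- For the direction `u = ℓ + τ·d` over `R[τ]` (and a constant base point), the Taylor coefficient `T_a(x; ℓ + τd)` has `τ`-degree
`≤ a` (ours). [cite: Lang2002, Ch. IV §1] -/
theorem natDegree_coeff_taylorLine_le {R : Type*} [CommRing R] [Algebra k R] (x ℓ d : ι → R) (F : MvPolynomial ι k) (a : ℕ) :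
    ((taylorLine (fun i => Polynomial.C (x i)) (fun i => Polynomial.C (ℓ i) + Polynomial.X * Polynomial.C (d i)) F).coeff a).natDegree
      ≤ a := by
  induction F using MvPolynomial.induction_on generalizing a with
  | C c =>
      rw [taylorLine_C, Polynomial.coeff_C]
      split_ifs with h
      · rw [Polynomial.algebraMap_apply, Polynomial.natDegree_C]
        exact Nat.zero_le _
      · simp
  | add p q hp hq =>
      rw [taylorLine_add, Polynomial.coeff_add]
      exact (Polynomial.natDegree_add_le _ _).trans (max_le (hp a) (hq a))
  | mul_X p i hp =>
      rw [taylorLine_mul, taylorLine_X]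
      cases a with
      | zero =>
          rw [coeff_mul_C_add_X_mul_C_zero]
          exact Polynomial.natDegree_mul_le.trans (by simpa using hp 0)
      | succ n =>
          rw [coeff_mul_C_add_X_mul_C_succ]
          refine (Polynomial.natDegree_add_le _ _).trans (max_le ?_ ?_)
          · exact Polynomial.natDegree_mul_le.trans (by simpa using hp (n + 1))
          · exact Polynomial.natDegree_mul_le.trans
              ((add_le_add (hp n) (natDegree_C_add_X_mul_C_le _ _)))

/-! ## The two-class substitution and its `σ`-layers -/

section Layers

variable {R : Type*} [CommRing R] [Algebra k R] {ι' : Type*}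

/-- `Q(y + σ^p c) ∈ R[σ]` — the `W`-class shift of THEOREM B″ (`W_j ↦ W_j + σ^p c_j`; ours). [cite: Lang2002, Ch. IV §1] -/
noncomputable def shiftQ (p : ℕ) (y c : ι' → R) (Q : MvPolynomial ι' k) : Polynomial R :=
  MvPolynomial.aeval (fun j => Polynomial.C (y j) + Polynomial.X ^ p * Polynomial.C (c j)) Q

/-- `F(x + σℓ + σ^{p+1} d) ∈ R[σ]` — the `f`-class shift of THEOREM B″ (`f_i ↦ f_i + σℓ_i(W) + σ^{p+1}d_i`; ours).
[cite: Lang2002, Ch. IV §1] -/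
noncomputable def shiftF (p : ℕ) (x ℓ d : ι → R) (F : MvPolynomial ι k) : Polynomial R :=
  MvPolynomial.aeval
    (fun i => Polynomial.C (x i) + Polynomial.X * Polynomial.C (ℓ i) + Polynomial.X ^ (p + 1) * Polynomial.C (d i)) F

/-- The MIXED Taylor coefficients `M_a := T_a(x; ℓ + τd) ∈ R[τ]` of `F` (ours): `F(x + s(ℓ + τd)) = Σ_a s^a M_a(τ)`.
[cite: Lang2002, Ch. IV §1] -/
noncomputable def mixedCoeff (x ℓ d : ι → R) (F : MvPolynomial ι k) (a : ℕ) : Polynomial R :=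
  (taylorLine (fun i => Polynomial.C (x i)) (fun i => Polynomial.C (ℓ i) + Polynomial.X * Polynomial.C (d i)) F).coeff a

/-- `M_a` has `τ`-degree `≤ a` (ours). [cite: Lang2002, Ch. IV §1] -/
theorem natDegree_mixedCoeff_le (x ℓ d : ι → R) (F : MvPolynomial ι k) (a : ℕ) :
    (mixedCoeff x ℓ d F a).natDegree ≤ a :=
  natDegree_coeff_taylorLine_le x ℓ d F a

/-- `M_a = 0` for `a > deg F` (ours). [cite: Lang2002, Ch. IV §1] -/
theorem mixedCoeff_eq_zero_of_totalDegree_lt (x ℓ d : ι → R) (F : MvPolynomial ι k) {a : ℕ} (h : F.totalDegree < a) :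
    mixedCoeff x ℓ d F a = 0 :=
  coeff_taylorLine_eq_zero_of_totalDegree_lt _ _ F h

/-- `[τ^b] M_a = 0` for `b > a` (ours). [cite: Lang2002, Ch. IV §1] -/
theorem coeff_mixedCoeff_eq_zero (x ℓ d : ι → R) (F : MvPolynomial ι k) {a b : ℕ} (h : a < b) :
    (mixedCoeff x ℓ d F a).coeff b = 0 :=
  Polynomial.coeff_eq_zero_of_natDegree_lt ((natDegree_mixedCoeff_le x ℓ d F a).trans_lt h)

/-- `M_a(0) = T_a(x; ℓ)`: setting `τ = 0` (ours). [cite: Lang2002, Ch. IV §1] -/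
theorem coeff_mixedCoeff_zero (x ℓ d : ι → R) (F : MvPolynomial ι k) (a : ℕ) :
    (mixedCoeff x ℓ d F a).coeff 0 = (taylorLine x ℓ F).coeff a := by
  have h := map_taylorLine ((Polynomial.aeval (R := R) (0 : R)).restrictScalars k) (fun i => Polynomial.C (x i))
    (fun i => Polynomial.C (ℓ i) + Polynomial.X * Polynomial.C (d i)) F
  have h' := congrArg (fun P : Polynomial R => P.coeff a) h
  simp only [Polynomial.coeff_map, AlgHom.coe_restrictScalars', Polynomial.coe_aeval_eq_eval,
    RingHom.coe_coe] at h'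
  rw [mixedCoeff, Polynomial.coeff_zero_eq_eval_zero]
  convert h' using 2
  simp

/-- `M_1 = Σ_i (ℓ_i + τ d_i) · ∂_i F(x)` (ours). [cite: Lang2002, Ch. IV §1] -/
theorem mixedCoeff_one [Fintype ι] [DecidableEq ι] (x ℓ d : ι → R) (F : MvPolynomial ι k) :
    mixedCoeff x ℓ d F 1 = ∑ i, (Polynomial.C (ℓ i) + Polynomial.X * Polynomial.C (d i)) *
      Polynomial.C (MvPolynomial.aeval x (MvPolynomial.pderiv i F)) := by
  rw [mixedCoeff, coeff_taylorLine_one]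
  refine Finset.sum_congr rfl fun i _ => ?_
  rw [aeval_C_base]

/-- `[τ¹] M_1 = Σ_i d_i ∂_i F(x)` (ours). [cite: Lang2002, Ch. IV §1] -/
theorem coeff_mixedCoeff_one_one [Fintype ι] [DecidableEq ι] (x ℓ d : ι → R) (F : MvPolynomial ι k) :
    (mixedCoeff x ℓ d F 1).coeff 1 = ∑ i, d i * MvPolynomial.aeval x (MvPolynomial.pderiv i F) := by
  rw [mixedCoeff_one, Polynomial.finsetSum_coeff]
  refine Finset.sum_congr rfl fun i _ => ?_
  rw [Polynomial.coeff_mul_C, show (1 : ℕ) = 0 + 1 from rfl, Polynomial.coeff_add, Polynomial.coeff_C,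
    if_neg (Nat.succ_ne_zero 0), Polynomial.coeff_X_mul, Polynomial.coeff_C_zero, zero_add]

/-- `M_n = F(ℓ + τ d) = taylorLine ℓ d F` for a form `F` of degree `n` (ours). [cite: Lang2002, Ch. IV §1] -/
theorem mixedCoeff_of_isHomogeneous (x ℓ d : ι → R) {F : MvPolynomial ι k} {n : ℕ} (hF : F.IsHomogeneous n) :
    mixedCoeff x ℓ d F n = taylorLine ℓ d F := by
  rw [mixedCoeff, coeff_taylorLine_of_isHomogeneous _ _ hF, taylorLine]

/-- `Q(y + σ^p c) = (F ↦ F(σ^p)) (Q(y + τ c))` (ours). [cite: Lang2002, Ch. IV §1] -/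
theorem shiftQ_eq_expand (p : ℕ) (y c : ι' → R) (Q : MvPolynomial ι' k) :
    shiftQ p y c Q = Polynomial.expand R p (taylorLine y c Q) := by
  induction Q using MvPolynomial.induction_on with
  | C a => simp [shiftQ, Polynomial.algebraMap_apply]
  | add P P' hP hP' =>
      simp only [shiftQ, map_add, taylorLine_add] at *
      rw [hP, hP']
  | mul_X P i hP =>
      simp only [shiftQ, map_mul, taylorLine_mul, taylorLine_X, MvPolynomial.aeval_X] at *
      rw [hP]
      simp [Polynomial.expand_X]

/-- `[σ^N] Q(y + σ^p c) = T_{N/p}(y; c)(Q)` if `p ∣ N`, else `0` (ours). [cite: Lang2002, Ch. IV §1] -/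
theorem coeff_shiftQ {p : ℕ} (hp : 0 < p) (y c : ι' → R) (Q : MvPolynomial ι' k) (N : ℕ) :
    (shiftQ p y c Q).coeff N = if p ∣ N then (taylorLine y c Q).coeff (N / p) else 0 := by
  rw [shiftQ_eq_expand, Polynomial.coeff_expand hp]

/-- `F(x + σℓ + σ^{p+1}d) = Σ_a σ^a · M_a(σ^p)`: the `f`-class shift is the Taylor polynomial along `ℓ + τ d` read on the diagonal
`s = σ`, `τ = σ^p` (ours). [cite: Lang2002, Ch. IV §1] -/
theorem shiftF_eq_eval₂ (p : ℕ) (x ℓ d : ι → R) (F : MvPolynomial ι k) :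
    shiftF p x ℓ d F = Polynomial.eval₂ (Polynomial.expand R p : Polynomial R →+* Polynomial R) Polynomial.X
      (taylorLine (fun i => Polynomial.C (x i)) (fun i => Polynomial.C (ℓ i) + Polynomial.X * Polynomial.C (d i)) F) := by
  induction F using MvPolynomial.induction_on with
  | C a => simp [shiftF, Polynomial.algebraMap_apply]
  | add P P' hP hP' =>
      simp only [shiftF, map_add, taylorLine_add, Polynomial.eval₂_add] at *
      rw [hP, hP']
  | mul_X P i hP =>
      simp only [shiftF, map_mul, taylorLine_mul, taylorLine_X, MvPolynomial.aeval_X, Polynomial.eval₂_mul] at *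
      rw [hP]
      simp [Polynomial.eval₂_add, Polynomial.eval₂_mul, Polynomial.expand_X]
      ring

/-- `[σ^N] F(x + σℓ + σ^{p+1}d) = Σ_{a ≤ N, p ∣ N − a} [τ^{(N−a)/p}] M_a` (ours). [cite: Lang2002, Ch. IV §1] -/
theorem coeff_shiftF {p : ℕ} (hp : 0 < p) (x ℓ d : ι → R) (F : MvPolynomial ι k) (N : ℕ) :
    (shiftF p x ℓ d F).coeff N =
      ∑ a ∈ Finset.range (N + 1), if p ∣ N - a then (mixedCoeff x ℓ d F a).coeff ((N - a) / p) else 0 := by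
  set Θ := taylorLine (fun i => Polynomial.C (x i)) (fun i => Polynomial.C (ℓ i) + Polynomial.X * Polynomial.C (d i)) F
    with hΘ
  have hdeg : Θ.natDegree < F.totalDegree + N + 1 :=
    lt_of_le_of_lt (natDegree_taylorLine_le _ _ F) (by omega)
  rw [shiftF_eq_eval₂, ← hΘ, Polynomial.eval₂_eq_sum_range' _ hdeg, Polynomial.finsetSum_coeff,
    ← Finset.sum_range_add_sum_Ico _ (show N + 1 ≤ F.totalDegree + N + 1 by omega),
    Finset.sum_eq_zero (s := Finset.Ico _ _), add_zero]
  · refine Finset.sum_congr rfl fun a ha => ?_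
    have haN : a ≤ N := by simpa [Nat.lt_succ_iff] using ha
    have hcoe : ∀ q : Polynomial R, (Polynomial.expand R p : Polynomial R →+* Polynomial R) q = Polynomial.expand R p q :=
      fun q => rfl
    simp only [Polynomial.coeff_mul_X_pow', if_pos haN]
    rw [hcoe, Polynomial.coeff_expand hp]
    rfl
  · intro a ha
    have haN : ¬ a ≤ N := by simp at ha; omega
    simp [Polynomial.coeff_mul_X_pow', haN]

/-- Reading ONE exponent `N = a₀ + p·b₀`: if every other decomposition `N = a + p·b` has `[τ^b] M_a = 0`, then
`[σ^N] F(x + σℓ + σ^{p+1}d) = [τ^{b₀}] M_{a₀}` (ours). [cite: Lang2002, Ch. IV §1] -/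
theorem coeff_shiftF_eq {p : ℕ} (hp : 0 < p) (x ℓ d : ι → R) (F : MvPolynomial ι k) {N a₀ b₀ : ℕ}
    (hN : N = a₀ + p * b₀) (hother : ∀ a b, a + p * b = N → a ≠ a₀ → (mixedCoeff x ℓ d F a).coeff b = 0) :
    (shiftF p x ℓ d F).coeff N = (mixedCoeff x ℓ d F a₀).coeff b₀ := by
  rw [coeff_shiftF hp, Finset.sum_eq_single_of_mem a₀ (by simp; omega)]
  · have h1 : N - a₀ = p * b₀ := by omega
    rw [h1, if_pos (dvd_mul_right p b₀), Nat.mul_div_cancel_left _ hp]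
  · intro a ha hne
    split_ifs with hdvd
    · obtain ⟨b, hb⟩ := hdvd
      have haN : a ≤ N := by simpa [Nat.lt_succ_iff] using ha
      rw [hb, Nat.mul_div_cancel_left _ hp]
      exact hother a b (by omega) hne
    · rfl

variable [Fintype ι] [DecidableEq ι] [Fintype ι'] [DecidableEq ι']
  {p : ℕ} {x ℓ d : ι → R} {F : MvPolynomial ι k} {y c : ι' → R} {Q : MvPolynomial ι' k}

omit [Fintype ι] [DecidableEq ι] [Fintype ι'] [DecidableEq ι'] in
/-- Under the isotropy identity, every positive `σ`-layer vanishes (ours, bookkeeping). [cite: Lang2002, Ch. IV §1] -/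
theorem coeff_add_coeff_eq_zero
    (layers : shiftF p x ℓ d F + shiftQ p y c Q = Polynomial.C (MvPolynomial.aeval x F + MvPolynomial.aeval y Q))
    {N : ℕ} (hN : N ≠ 0) : (shiftF p x ℓ d F).coeff N + (shiftQ p y c Q).coeff N = 0 := by
  have h := congrArg (fun P : Polynomial R => P.coeff N) layers
  simp only [Polynomial.coeff_add, Polynomial.coeff_C, if_neg hN] at h
  exact h

omit [Fintype ι'] [DecidableEq ι'] in
/-- **Layer `σ¹`** (THEOREM-LT §11 step 1: "`σ¹ : Σ_i ℓ_i ∂_{f_i}F = 0`"; ours): `Σ_i ℓ_i · ∂_i F(x) = 0`.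
[cite: Lang2002, Ch. IV §1] -/
theorem layer_one (hp : 2 ≤ p)
    (layers : shiftF p x ℓ d F + shiftQ p y c Q = Polynomial.C (MvPolynomial.aeval x F + MvPolynomial.aeval y Q)) :
    ∑ i, ℓ i * MvPolynomial.aeval x (MvPolynomial.pderiv i F) = 0 := by
  have h := coeff_add_coeff_eq_zero layers one_ne_zero
  have hQ : (shiftQ p y c Q).coeff 1 = 0 := by
    rw [coeff_shiftQ (by omega), if_neg]
    intro h1
    have := Nat.le_of_dvd one_pos h1
    omega
  have hF : (shiftF p x ℓ d F).coeff 1 = ∑ i, ℓ i * MvPolynomial.aeval x (MvPolynomial.pderiv i F) := by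
    rw [coeff_shiftF_eq (by omega) x ℓ d F (N := 1) (a₀ := 1) (b₀ := 0) (by simp), coeff_mixedCoeff_zero,
      coeff_taylorLine_one]
    intro a b hab hne
    rcases Nat.eq_zero_or_pos b with rfl | hb
    · simp at hab; exact absurd hab hne
    · have : p ≤ p * b := Nat.le_mul_of_pos_right p hb
      omega
  rwa [hQ, add_zero, hF] at h

omit [Fintype ι] [DecidableEq ι] [Fintype ι'] [DecidableEq ι'] in
/-- **Layers `σ^m`, `2 ≤ m < p`** (ours): the intermediate Taylor coefficients `T_m(x; ℓ)(F)` vanish.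
[cite: Lang2002, Ch. IV §1] -/
theorem layer_lt {m : ℕ} (hm : 2 ≤ m) (hmp : m < p)
    (layers : shiftF p x ℓ d F + shiftQ p y c Q = Polynomial.C (MvPolynomial.aeval x F + MvPolynomial.aeval y Q)) :
    (taylorLine x ℓ F).coeff m = 0 := by
  have h := coeff_add_coeff_eq_zero layers (show m ≠ 0 by omega)
  have hQ : (shiftQ p y c Q).coeff m = 0 := by
    rw [coeff_shiftQ (by omega), if_neg]
    intro h1
    have := Nat.le_of_dvd (by omega) h1
    omega
  have hF : (shiftF p x ℓ d F).coeff m = (taylorLine x ℓ F).coeff m := by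
    rw [coeff_shiftF_eq (by omega) x ℓ d F (N := m) (a₀ := m) (b₀ := 0) (by simp), coeff_mixedCoeff_zero]
    intro a b hab hne
    rcases Nat.eq_zero_or_pos b with rfl | hb
    · simp at hab; exact absurd hab hne
    · have : p ≤ p * b := Nat.le_mul_of_pos_right p hb
      omega
  rwa [hQ, add_zero, hF] at h

omit [Fintype ι] [DecidableEq ι] in
/-- **Layer `σ^p`** (THEOREM-LT §11 step 1: "`σ^p : F(ℓ(W)) + Σ_j c_j ∂_{W_j} Q = 0`", whence `Q₁ = −Σ a_i ℓ_i^p`; ours), for a form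
`F` of degree `p`: `F(ℓ) + Σ_j c_j · ∂_j Q(y) = 0`. [cite: Lang2002, Ch. IV §1] -/
theorem layer_p (hp : 2 ≤ p) (hF : F.IsHomogeneous p)
    (layers : shiftF p x ℓ d F + shiftQ p y c Q = Polynomial.C (MvPolynomial.aeval x F + MvPolynomial.aeval y Q)) :
    MvPolynomial.aeval ℓ F + ∑ j, c j * MvPolynomial.aeval y (MvPolynomial.pderiv j Q) = 0 := by
  have h := coeff_add_coeff_eq_zero layers (show p ≠ 0 by omega)
  have hQ : (shiftQ p y c Q).coeff p = ∑ j, c j * MvPolynomial.aeval y (MvPolynomial.pderiv j Q) := by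
    rw [coeff_shiftQ (by omega), if_pos (dvd_refl p), Nat.div_self (by omega), coeff_taylorLine_one]
  have hF' : (shiftF p x ℓ d F).coeff p = MvPolynomial.aeval ℓ F := by
    rw [coeff_shiftF_eq (by omega) x ℓ d F (N := p) (a₀ := p) (b₀ := 0) (by simp), coeff_mixedCoeff_zero,
      coeff_taylorLine_of_isHomogeneous _ _ hF]
    intro a b hab hne
    rcases Nat.eq_zero_or_pos b with rfl | hb
    · simp at hab; exact absurd hab hne
    · have hpb : p ≤ p * b := Nat.le_mul_of_pos_right p hb
      have ha : a = 0 := by omega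
      subst ha
      exact coeff_mixedCoeff_eq_zero x ℓ d F hb
  rwa [hQ, hF'] at h

omit [Fintype ι'] [DecidableEq ι'] in
/-- **Layer `σ^{p+1}`** (THEOREM-LT §11 step 1: "`σ^{p+1} : Σ_i d_i ∂_{f_i} F = 0`"; ours), for a form `F` of degree `p`:
`Σ_i d_i · ∂_i F(x) = 0`. [cite: Lang2002, Ch. IV §1] -/
theorem layer_succ (hp : 2 ≤ p) (hF : F.IsHomogeneous p)
    (layers : shiftF p x ℓ d F + shiftQ p y c Q = Polynomial.C (MvPolynomial.aeval x F + MvPolynomial.aeval y Q)) :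
    ∑ i, d i * MvPolynomial.aeval x (MvPolynomial.pderiv i F) = 0 := by
  have h := coeff_add_coeff_eq_zero layers (show p + 1 ≠ 0 by omega)
  have hQ : (shiftQ p y c Q).coeff (p + 1) = 0 := by
    rw [coeff_shiftQ (by omega), if_neg]
    intro h1
    have h2 : p ∣ 1 := (Nat.dvd_add_right (dvd_refl p)).mp h1
    have := Nat.le_of_dvd one_pos h2
    omega
  have hF' : (shiftF p x ℓ d F).coeff (p + 1) = ∑ i, d i * MvPolynomial.aeval x (MvPolynomial.pderiv i F) := by
    rw [coeff_shiftF_eq (by omega) x ℓ d F (N := p + 1) (a₀ := 1) (b₀ := 1) (by ring), coeff_mixedCoeff_one_one]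
    intro a b hab hne
    rcases Nat.lt_trichotomy b 1 with hb | rfl | hb
    · have hb0 : b = 0 := by omega
      subst hb0
      have ha : a = p + 1 := by simpa using hab
      subst ha
      rw [mixedCoeff_eq_zero_of_totalDegree_lt x ℓ d F (lt_of_le_of_lt hF.totalDegree_le (Nat.lt_succ_self p)),
        Polynomial.coeff_zero]
    · simp at hab; exact absurd (by omega : a = 1) hne
    · have : p * 2 ≤ p * b := Nat.mul_le_mul_left p hb
      omega
  rwa [hQ, add_zero, hF'] at h

omit [Fintype ι] [DecidableEq ι] [Fintype ι'] [DecidableEq ι'] in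
/-- **Layers `σ^{jp}`, `2 ≤ j ≤ p+1`** (THEOREM-LT §11 step 1: "`σ^{jp} : D_c^{(j)}Q = 0`" up to the `F`-term killed by the normal
form; ours), for a form `F` of degree `p`: `T_j(y; c)(Q) + T_{j−1}(ℓ; d)(F) = 0`, the second summand being the `τ^{j−1}`-coefficient of
`F(ℓ + τd)`. [cite: Lang2002, Ch. IV §1] -/
theorem layer_mul (hp : 2 ≤ p) (hF : F.IsHomogeneous p) {j : ℕ} (hj : 2 ≤ j) (hjp : j ≤ p + 1)
    (layers : shiftF p x ℓ d F + shiftQ p y c Q = Polynomial.C (MvPolynomial.aeval x F + MvPolynomial.aeval y Q)) :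
    (taylorLine y c Q).coeff j + (taylorLine ℓ d F).coeff (j - 1) = 0 := by
  obtain ⟨i, rfl⟩ : ∃ i, j = i + 1 := ⟨j - 1, by omega⟩
  have h := coeff_add_coeff_eq_zero layers (show p * (i + 1) ≠ 0 from Nat.mul_ne_zero (by omega) (by omega))
  have hQ : (shiftQ p y c Q).coeff (p * (i + 1)) = (taylorLine y c Q).coeff (i + 1) := by
    rw [coeff_shiftQ (by omega), if_pos (dvd_mul_right p _), Nat.mul_div_cancel_left _ (by omega)]
  have hF' : (shiftF p x ℓ d F).coeff (p * (i + 1)) = (taylorLine ℓ d F).coeff i := by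
    rw [coeff_shiftF_eq (by omega) x ℓ d F (N := p * (i + 1)) (a₀ := p) (b₀ := i) (by ring),
      mixedCoeff_of_isHomogeneous x ℓ d hF]
    intro a b hab hne
    have hpa : p ∣ a := by
      have h1 : p ∣ p * b + a := by rw [add_comm, hab]; exact dvd_mul_right p _
      exact (Nat.dvd_add_right (dvd_mul_right p b)).mp h1
    obtain ⟨m, rfl⟩ := hpa
    rcases Nat.lt_trichotomy m 1 with hm | rfl | hm
    · have hm0 : m = 0 := by omega
      subst hm0
      have hb : 0 < b := by
        rcases Nat.eq_zero_or_pos b with rfl | hb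
        · simp at hab
          omega
        · exact hb
      simpa using coeff_mixedCoeff_eq_zero x ℓ d F hb
    · simp at hne
    · have h2 : p * 2 ≤ p * m := Nat.mul_le_mul_left p hm
      rw [mixedCoeff_eq_zero_of_totalDegree_lt x ℓ d F (lt_of_le_of_lt hF.totalDegree_le (by omega)),
        Polynomial.coeff_zero]
  rw [hQ, hF', add_comm] at h
  simpa [add_comm] using h

omit [Fintype ι] [DecidableEq ι] [Fintype ι'] [DecidableEq ι'] in
/-- **Top layer `σ^{p(p+1)}`** (THEOREM-LT §11 step 1: "`Σ_i a_i d_i^p + F₀(d″) + Q(c) = 0`", i.e. `F(d) + Q(c) = 0`; ours), for forms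
`F` of degree `p` and `Q` of degree `p+1`. [cite: Lang2002, Ch. IV §1] -/
theorem layer_top (hp : 2 ≤ p) (hF : F.IsHomogeneous p) (hQ : Q.IsHomogeneous (p + 1))
    (layers : shiftF p x ℓ d F + shiftQ p y c Q = Polynomial.C (MvPolynomial.aeval x F + MvPolynomial.aeval y Q)) :
    MvPolynomial.aeval d F + MvPolynomial.aeval c Q = 0 := by
  have h := layer_mul hp hF (j := p + 1) (by omega) le_rfl layers
  rw [coeff_taylorLine_of_isHomogeneous _ _ hQ, Nat.add_sub_cancel, coeff_taylorLine_of_isHomogeneous _ _ hF,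
    add_comm] at h
  exact h

end Layers

section PropF

/-! ## PROPOSITION F, menu (i) — the analytic step packaged (THEOREM-LT §15; CARVER T71 (a); v2, carver-g59)

Engine 1's PROPOSITION F on menu (i) (`N = f ⊔ W`, weights `1/p` on `f` and `1/(p+1)` on `W`): a graded isotropy `X` of degree
`ρ₁ = 1/(p(p+1))` WITHOUT pure `W`-term fixes `W` and moves `f ↦ f + σM(W) + σ^{p+1}b` (weight bookkeeping, not typed), and `g = F(f) + Q(W)`;
so `g∘X = g` reads `F(x + σℓ + σ^{p+1}d) = F(x)` in `R[σ]`, `R = k[f, W]`, `x = f`, `ℓ = M(W)`, `d = b` — the `layers` hypothesis of this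
file with `Q := 0`.  The engine's "only analytic step" (T71 (a): the `σ`-exponent count `d + pj`, alias `sigma_order_of_mixed_term`) IS
`layer_one` / `layer_lt` / `layer_p` above; this section packages its two consequences:
* `taylorLine_eq_C_of_shiftF_eq_C` — ALL one-parameter Taylor (Hasse) coefficients of `F` along `ℓ` vanish: `F(x + sℓ) = F(x)` in `R[s]`
  ("`F` is translation-invariant along `v = M(W)`"); specialise `W ↦ W₀` by `taylorLine_eq_C_map` to a constant direction `v₀ = M(W₀)`,
  which un-pins an `f`-slot (`WeightedCentreInvariantDirection`, T67) — against (P); so `M = 0`;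
* `taylorLine_eq_C_of_shiftF_zero_eq_C` — then `F(x + σ^{p+1}d) = F(x)` gives `F(x + τd) = F(x)` (`expand` is injective) and the same
  argument gives `d = 0`, i.e. `X = id`.
NOT here: the weight bookkeeping, menu (ii), LEMMA F0, and the reading "THEOREM U / C3 unconditional on these menus" (modelling; by
EXAMPLE L, `WeightedCentreExampleL`, any 'complete list' reading must carry the slot floor `w_min = 1/(p+1)`, hypothesis (R0)).
-/

variable {R : Type*} [CommRing R] [Algebra k R] {p : ℕ} {x ℓ d : ι → R} {F : MvPolynomial ι k}

omit [CommRing A] [Algebra k A] in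
/-- With no `W`-class the isotropy identity `F(x + σℓ + σ^{p+1}d) = F(x)` is the `layers` hypothesis with `Q := 0` (bookkeeping; ours).
[cite: Lang2002, Ch. IV §1] -/
theorem layers_of_shiftF_eq_C (h : shiftF p x ℓ d F = Polynomial.C (MvPolynomial.aeval x F)) :
    shiftF p x ℓ d F + shiftQ p (fun _ : Fin 0 => (0 : R)) (fun _ => 0) (0 : MvPolynomial (Fin 0) k)
      = Polynomial.C (MvPolynomial.aeval x F + MvPolynomial.aeval (fun _ : Fin 0 => (0 : R)) (0 : MvPolynomial (Fin 0) k)) := by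
  simp [shiftQ, h]

omit [CommRing A] [Algebra k A] in
/-- **PROPOSITION F (i), analytic step** (THEOREM-LT §15: "the Hasse derivatives `D_v^{(e)}F` (`1 ≤ e ≤ p − 1`) vanish identically and
`D_v^{(p)}F = F(v) = 0`; together `F(f + tv) = F(f)` identically"; ours): for a form `F` of degree `p ≥ 2` over any commutative `k`-algebra
`R`, `F(x + σℓ + σ^{p+1}d) = F(x)` in `R[σ]` implies `F(x + sℓ) = F(x)` in `R[s]`. [cite: Lang2002, Ch. IV §1] -/
theorem taylorLine_eq_C_of_shiftF_eq_C [Fintype ι] [DecidableEq ι] (hp : 2 ≤ p) (hF : F.IsHomogeneous p)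
    (h : shiftF p x ℓ d F = Polynomial.C (MvPolynomial.aeval x F)) :
    taylorLine x ℓ F = Polynomial.C (MvPolynomial.aeval x F) := by
  have layers := layers_of_shiftF_eq_C h
  ext m
  rw [Polynomial.coeff_C]
  rcases Nat.eq_zero_or_pos m with rfl | hm0
  · rw [if_pos rfl]
    exact coeff_taylorLine_zero x ℓ F
  rw [if_neg (by omega)]
  rcases lt_or_ge p m with hpm | hmp
  · exact coeff_taylorLine_eq_zero_of_totalDegree_lt x ℓ F (lt_of_le_of_lt hF.totalDegree_le hpm)
  rcases eq_or_lt_of_le hmp with hmp | hmp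
  · rw [hmp, coeff_taylorLine_of_isHomogeneous x ℓ hF]
    simpa using layer_p hp hF layers
  by_cases h1 : m = 1
  · subst h1
    rw [coeff_taylorLine_one]
    exact layer_one hp layers
  · exact layer_lt (by omega) hmp layers

omit [CommRing A] [Algebra k A] in
/-- With `ℓ = 0`: `F(x + σ^{p+1}d) = (P ↦ P(σ^{p+1}))(F(x + τd))` (bookkeeping; ours). [cite: Lang2002, Ch. IV §1] -/
theorem shiftF_zero_eq_expand (p : ℕ) (x d : ι → R) (F : MvPolynomial ι k) :
    shiftF p x 0 d F = Polynomial.expand R (p + 1) (taylorLine x d F) := by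
  rw [← shiftQ_eq_expand]
  simp only [shiftF, shiftQ, Pi.zero_apply, map_zero, mul_zero, add_zero]

omit [CommRing A] [Algebra k A] in
/-- **PROPOSITION F (i), the `b`-step** (THEOREM-LT §15: "then `F(f + τb) = F(f)` identically in `τ = σ^{p+1}` and the same argument gives
`b = 0`"; ours): `F(x + σ^{p+1}d) = F(x)` in `R[σ]` implies `F(x + τd) = F(x)` in `R[τ]`. [cite: Lang2002, Ch. IV §1] -/
theorem taylorLine_eq_C_of_shiftF_zero_eq_C (p : ℕ) (x d : ι → R) (F : MvPolynomial ι k)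
    (h : shiftF p x 0 d F = Polynomial.C (MvPolynomial.aeval x F)) :
    taylorLine x d F = Polynomial.C (MvPolynomial.aeval x F) := by
  have e : Polynomial.expand R (p + 1) (taylorLine x d F) = Polynomial.expand R (p + 1) (Polynomial.C (MvPolynomial.aeval x F)) := by
    rw [Polynomial.expand_C, ← shiftF_zero_eq_expand, h]
  exact (Polynomial.expand_inj (by omega)).mp e

omit [CommRing A] [Algebra k A] in
/-- Specialisation (THEOREM-LT §15: "if `M ≠ 0` pick `W₀ ∈ kⁿ` with `v₀ := M(W₀) ≠ 0`"; ours): translation-invariance `F(x + su) = F(x)` over `R`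
passes to `F(ψx + s·ψu) = F(ψx)` over `B` along any `k`-algebra map `ψ : R → B`. [cite: Lang2002, Ch. IV §1] -/
theorem taylorLine_eq_C_map {B : Type*} [CommRing B] [Algebra k B] (ψ : R →ₐ[k] B) {x u : ι → R} {F : MvPolynomial ι k}
    (h : taylorLine x u F = Polynomial.C (MvPolynomial.aeval x F)) :
    taylorLine (fun i => ψ (x i)) (fun i => ψ (u i)) F = Polynomial.C (MvPolynomial.aeval (fun i => ψ (x i)) F) := by
  rw [← map_taylorLine ψ, h, Polynomial.map_C]
  congr 1
  exact DFunLike.congr_fun (MvPolynomial.comp_aeval (f := x) ψ) F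

end PropF

end TaylorLayers

end Literature.AlgebraicGeometry.Resolution.WeightedBlowup
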